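import Literature.AnabelianGeometry.EtaleTheta.GalSectCuspPairTorsors
import HarnessLib

/-!
# Push-forward of a cuspidal pair `(D, I)` along an injective continuous homomorphism (e.g. `Π^tp_X ↪ Π^tp_C`)

S. Mochizuki, *Galois sections in absolute anabelian geometry* [GalSect], Nagoya Math. J. **179** (2005), §4 p. 33 («`1 → I_x → D_x →
G_K → 1`», splittings, «the splittings … form a torsor») [cite: MochizukiGalSect2005, §4 p.33]; S. Mochizuki, *The étale theta function …*
[EtTh], Def. 1.7 p. 27 (`X^log → C^log`, `Π^tp_X ↪ Π^tp_C`) [cite: MochizukiEtTh2009, Def 1.7 p.27].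

abc-iut cell, layer L2, seat abc-iut-w5-d029 (gen 5).  Class (b): ONE definition (`CuspPair.pushforward`) + ONE `≃ₜ*` constructor + lemmas; no
instance, no `Prop` fact, no frozen interface touched.  abc-iut-w5-d062's `CuspPair.map` transports a pair along an ISOMORPHISM `G ≃ₜ* G'`
(`GalSectSplittingsTransport`); [EtTh] Thm. 1.10 (iii)'s cusp datum (`MuTwoSetting.DotCCusp`) needs the pair of a cusp of `X` read INSIDE `Π^tp_C`
along the (non-surjective) open embedding `inclX : Π^tp_X ↪ Π^tp_C`.  This file supplies that push-forward:

* `CuspPair.pushforward P f` — `(D, I) ↦ (f(D), f(I))` for any `f : G →* G'` (`I ≤ D`, `I` normalised by `D` are preserved);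
* `map_mem_splittings_pushforward` — a splitting `S` of `P` pushes to a splitting `f(S)` of `P.pushforward f` when `f` is a CLOSED EMBEDDING
  (closedness is the only topological clause of `splittings`; `S ∩ I = 1`, `S·I = D` push along an injective hom);
* `subgroupEquivMap` — for an embedding `f`, `↥H ≃ₜ* ↥(H.map f)`; hence `inertiaEquivPushforward` — `f(I) ≃ₜ* Ẑ` from `I ≃ₜ* Ẑ`;
* `pushforward_D_inf_range` — `f(D) ∩ f(G) = f(D)` (the `D_inf_range` clause of `DotCCusp` with `conj := 1`).

[GalSect]/[EtTh] refereed; typed ≠ proved; no side taken on [IUTchIII] Cor. 3.12.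
-/

noncomputable section

namespace Literature.AnabelianGeometry.EtaleTheta.GalSect

open _root_.Topology
open scoped Pointwise

namespace CuspPair

variable {G G' : Type*} [Group G] [TopologicalSpace G] [Group G'] [TopologicalSpace G']

omit [TopologicalSpace G] [TopologicalSpace G'] in
/-- Conjugation commutes with a homomorphism: `conj (f d) ∘ f = f ∘ conj d`. [cite: MochizukiGalSect2005, §4 p.33] -/
theorem conj_comp_eq (f : G →* G') (d : G) :
    (MulAut.conj (f d)).toMonoidHom.comp f = f.comp (MulAut.conj d).toMonoidHom := by
  ext x
  simp [MulAut.conj_apply, map_mul, map_inv]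

omit [TopologicalSpace G] [TopologicalSpace G'] in
/-- `conj (f d) • (H.map f) = (conj d • H).map f`. [cite: MochizukiGalSect2005, §4 p.33] -/
theorem conj_smul_map (f : G →* G') (d : G) (H : Subgroup G) :
    MulAut.conj (f d) • H.map f = (MulAut.conj d • H).map f := by
  rw [Subgroup.pointwise_smul_def, Subgroup.pointwise_smul_def, Subgroup.map_map, Subgroup.map_map]
  exact congrArg (fun φ : G →* G' => H.map φ) (conj_comp_eq f d)

/-- **Push-forward of a cuspidal pair along a homomorphism**: `(D, I) ↦ (f(D), f(I))`. [cite: MochizukiGalSect2005, §4 p.33] -/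
def pushforward (P : CuspPair G) (f : G →* G') : CuspPair G' where
  D := P.D.map f
  I := P.I.map f
  I_le := Subgroup.map_mono P.I_le
  conj_I := by
    rintro _ ⟨d, hd, rfl⟩
    rw [conj_smul_map, P.conj_I d hd]

/-- [cite: MochizukiGalSect2005, §4 p.33] -/
@[simp] theorem pushforward_D (P : CuspPair G) (f : G →* G') : (P.pushforward f).D = P.D.map f := rfl

/-- [cite: MochizukiGalSect2005, §4 p.33] -/
@[simp] theorem pushforward_I (P : CuspPair G) (f : G →* G') : (P.pushforward f).I = P.I.map f := rfl

/-- `f(D) ∩ f(G) = f(D)` — the shape of `DotCCusp.D_inf_range` with `conj := 1`. [cite: MochizukiEtTh2009, Thm 1.10 (iii) p.30] -/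
theorem pushforward_D_inf_range (P : CuspPair G) (f : G →* G') :
    (P.pushforward f).D ⊓ f.range = (MulAut.conj (1 : G) • P.D).map f := by
  rw [map_one, one_smul, pushforward_D]
  exact inf_eq_left.mpr (Subgroup.map_le_range f P.D)

/-- **A splitting pushes forward to a splitting** along a closed embedding (closed image; `f(S) ∩ f(I) = f(S ∩ I) = 1`, `f(S)·f(I) = f(D)`).
[cite: MochizukiGalSect2005, §4 p.33] -/
theorem map_mem_splittings_pushforward (P : CuspPair G) {f : G →* G'} (hf : IsClosedEmbedding f) {S : Subgroup G}
    (hS : S ∈ P.splittings) : S.map f ∈ (P.pushforward f).splittings := by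
  obtain ⟨hcl, hle, hinf, hsup⟩ := hS
  refine ⟨?_, Subgroup.map_mono hle, ?_, ?_⟩
  · rw [Subgroup.coe_map]
    exact hf.isClosedMap _ hcl
  · rw [pushforward_I, ← Subgroup.map_inf _ _ f hf.injective, hinf, Subgroup.map_bot]
  · rw [pushforward_I, pushforward_D, ← Subgroup.map_sup, hsup]

/-- **`↥H ≃ₜ* ↥(H.map f)` for an embedding `f`** (algebraically `Subgroup.equivMapOfInjective`; the inverse is continuous because `f` is an
embedding). [cite: MochizukiGalSect2005, §4 p.33] -/
def subgroupEquivMap (H : Subgroup G) (f : G →* G') (hc : Continuous f) (hf : IsEmbedding f) : ↥H ≃ₜ* ↥(H.map f) where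
  toMulEquiv := Subgroup.equivMapOfInjective H f hf.injective
  continuous_toFun := by
    refine Continuous.subtype_mk (hc.comp continuous_subtype_val) _
  continuous_invFun := by
    have key : Continuous (fun y : ↥(H.map f) => ((Subgroup.equivMapOfInjective H f hf.injective).symm y : G)) := by
      rw [hf.continuous_iff]
      have h2 : (f ∘ fun y : ↥(H.map f) => ((Subgroup.equivMapOfInjective H f hf.injective).symm y : G)) =
          fun y : ↥(H.map f) => (y : G') := by
        funext y
        change f ((Subgroup.equivMapOfInjective H f hf.injective).symm y : G) = (y : G')
        have := Subgroup.coe_equivMapOfInjective_apply H f hf.injective ((Subgroup.equivMapOfInjective H f hf.injective).symm y)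
        rw [MulEquiv.apply_symm_apply] at this
        exact this.symm
      rw [h2]
      exact continuous_subtype_val
    exact key.subtype_mk _

/-- [cite: MochizukiGalSect2005, §4 p.33] -/
theorem subgroupEquivMap_apply_coe (H : Subgroup G) (f : G →* G') (hc : Continuous f) (hf : IsEmbedding f) (x : H) :
    ((subgroupEquivMap H f hc hf x : ↥(H.map f)) : G') = f x := rfl

/-- **`f(I) ≃ₜ* Ẑ` from `I ≃ₜ* Ẑ`** along an embedding. [cite: MochizukiSemiAnbd2006, §6 p.71] -/
def inertiaEquivPushforward (P : CuspPair G) {f : G →* G'} (hc : Continuous f) (hf : IsEmbedding f) {Z : Type*} [Group Z]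
    [TopologicalSpace Z] (e₀ : ↥P.I ≃ₜ* Z) : ↥(P.pushforward f).I ≃ₜ* Z :=
  (subgroupEquivMap P.I f hc hf).symm.trans e₀

end CuspPair

end Literature.AnabelianGeometry.EtaleTheta.GalSect

end
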